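import Literature.NumberTheory.Sieve.FordMaynardFragOpSymm
import Literature.NumberTheory.Sieve.FordMaynardSlab
import HarnessLib

/-!
# Ford–Maynard's fragmentation operator: the measure argument

Quantitative form of the measure arguments in the proofs of Theorem 6.3 (a) ((fh1), §6.2) and
Theorem 9.1 (§9) of K. Ford, J. Maynard, *On the theory of prime producing sieves*
(arXiv:2407.14368): if `g` is supported on vectors having a nonempty proper subsum in a union of
short intervals of total length `w`, then `|fragOp γ η g (ξ)| ≤ C(m, η) · sup|g| · w` at every
`ξ ∈ ℝ^m` which itself has no such subsum (`abs_fragOp_badInd_le`). Everything here is PROVED.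
Mechanism: in the flat coordinates `U` of (6.3), a subsum of the fragmentation over an index set
which is not a union of whole blocks is affine in some free coordinate with slope `±1`
(`subsumFn_update`, `exists_slope_of_mixed`), so the corresponding set of `U` is a thin slab
(`FordMaynardSlab.lean`); subsums over unions of whole blocks are subsums of `ξ`.

## References

* K. Ford, J. Maynard, *On the theory of prime producing sieves*, arXiv:2407.14368v1 (2024), §6.2
  (proof of (fh1)) and §9 (proof of (f-ftilde)). [FordMaynard2024PrimeSieves]
-/

noncomputable section

open MeasureTheory Finset

namespace Literature.NumberTheory.Sieve.FordMaynard

variable {m N : ℕ}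

/-! ### The fragmentation read off the flat coordinates, and its subsums -/

/-- The fragmentation `(u₁, …, u_m) ∈ ℝ^{k₁+⋯+k_m}` of `ξ` read off the flat coordinates `U`.
[cite: FordMaynard2024PrimeSieves, §6.1 (6.3)] -/
def flatFrag (kv : Fin m → ℕ) (ξ : Fin m → ℝ) (U : Fin m × Fin N → ℝ) : Fin (∑ j, kv j) → ℝ :=
  concatBlocks kv fun j => blockVec (kv j) (ξ j) (rowOf U j)

/-- The subsum of the fragmentation over the index set `A`, as a function of `U`.
[cite: FordMaynard2024PrimeSieves, §9 (proof of Theorem 9.1, the subsum A)] -/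
def subsumFn (kv : Fin m → ℕ) (ξ : Fin m → ℝ) (A : Finset (Fin (∑ j, kv j)))
    (U : Fin m × Fin N → ℝ) : ℝ :=
  ∑ t ∈ A, flatFrag kv ξ U t

/-- Entries of `flatFrag`. [folklore] -/
theorem flatFrag_apply (kv : Fin m → ℕ) (ξ : Fin m → ℝ) (U : Fin m × Fin N → ℝ)
    (p : (j : Fin m) × Fin (kv j)) :
    flatFrag kv ξ U (finSigmaFinEquiv (n := kv) p) = blockVec (kv p.1) (ξ p.1) (rowOf U p.1) p.2 := by
  unfold flatFrag; rw [concatBlocks_apply_equiv]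

/-- `subsumFn` is measurable in `U`. [folklore] -/
theorem measurable_subsumFn (kv : Fin m → ℕ) (ξ : Fin m → ℝ) (A : Finset (Fin (∑ j, kv j))) :
    Measurable (subsumFn (N := N) kv ξ A) := by
  unfold subsumFn flatFrag
  exact Finset.measurable_sum _ fun t _ =>
    (measurable_pi_apply t).comp (measurable_concatBlocks_blockVec kv ξ)

/-! ### The effect of changing one free coordinate -/

/-- Rows after updating one flat coordinate. [folklore] -/
theorem rowOf_update (U : Fin m × Fin N → ℝ) (j₀ : Fin m) (i₀ : Fin N) (u : ℝ) (j : Fin m) :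
    rowOf (Function.update U (j₀, i₀) u) j =
      if j = j₀ then Function.update (rowOf U j₀) (i₀ : ℕ) u else rowOf U j := by
  funext i
  unfold rowOf
  by_cases hj : j = j₀
  · subst hj
    rw [if_pos rfl]
    by_cases hi : i < N
    · rw [dif_pos hi, Function.update_apply, Function.update_apply, dif_pos hi]
      by_cases hii : i = (i₀ : ℕ)
      · subst hii
        simp
      · rw [if_neg, if_neg hii]
        intro h
        exact hii (by have := congrArg (fun q : Fin m × Fin N => (q.2 : ℕ)) h; simpa using this)
    · rw [dif_neg hi, Function.update_apply, if_neg (fun h => hi (by rw [h]; exact i₀.2)), dif_neg hi]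
  · rw [if_neg hj]
    by_cases hi : i < N
    · rw [dif_pos hi, dif_pos hi, Function.update_apply, if_neg]
      intro h; exact hj (congrArg Prod.fst h)
    · rw [dif_neg hi, dif_neg hi]

/-- Changing a free coordinate of a block: the free entry moves with slope `1`, the last entry
with slope `−1`, the others do not move. [folklore] -/
theorem blockVec_update_sub (k : ℕ) (α : ℝ) (r : ℕ → ℝ) {i₀ : ℕ} (hi₀ : i₀ + 1 < k) (u : ℝ)
    (i : Fin k) :
    blockVec k α (Function.update r i₀ u) i - blockVec k α r i =
      ((if (i : ℕ) = i₀ then 1 else 0) - (if (i : ℕ) + 1 < k then 0 else 1)) * (u - r i₀) := by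
  unfold blockVec
  by_cases hfree : (i : ℕ) + 1 < k
  · rw [if_pos hfree, if_pos hfree, if_pos hfree, Function.update_apply]
    by_cases hii : (i : ℕ) = i₀
    · rw [if_pos hii, if_pos hii, hii]; ring
    · rw [if_neg hii, if_neg hii]; ring
  · rw [if_neg hfree, if_neg hfree, if_neg hfree]
    have hii : (i : ℕ) ≠ i₀ := by omega
    rw [if_neg hii]
    have hsum : ∑ i' ∈ Finset.range (k - 1), Function.update r i₀ u i' =
        (∑ i' ∈ Finset.range (k - 1), r i') + (u - r i₀) := by
      have hmem : i₀ ∈ Finset.range (k - 1) := Finset.mem_range.2 (by omega)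
      rw [Finset.sum_update_of_mem hmem, ← Finset.add_sum_erase _ _ hmem, Finset.sdiff_singleton_eq_erase]
      ring
    rw [hsum]; ring

/-- **One free coordinate moves a subsum with slope `𝟙[t₁ ∈ A] − 𝟙[t₂ ∈ A]`**, where `t₁` is the
index of the free entry `(j₀, i₀)` and `t₂` that of the last entry of block `j₀`.
[cite: FordMaynard2024PrimeSieves, §9 (proof of Theorem 9.1: "A' is fixed and u_{j',i'}+u_{j',i''} is fixed")] -/
theorem subsumFn_update (kv : Fin m → ℕ) (ξ : Fin m → ℝ) (A : Finset (Fin (∑ j, kv j)))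
    (U : Fin m × Fin N → ℝ) {j₀ : Fin m} {i₀ : Fin N} (hi₀ : (i₀ : ℕ) + 1 < kv j₀) (u : ℝ) :
    subsumFn kv ξ A (Function.update U (j₀, i₀) u) =
      subsumFn kv ξ A U +
        ((if finSigmaFinEquiv (n := kv) ⟨j₀, ⟨i₀, by omega⟩⟩ ∈ A then 1 else 0) -
          (if finSigmaFinEquiv (n := kv) ⟨j₀, ⟨kv j₀ - 1, by omega⟩⟩ ∈ A then 1 else 0)) *
          (u - U (j₀, i₀)) := by
  classical
  set t₁ : Fin (∑ j, kv j) := finSigmaFinEquiv (n := kv) ⟨j₀, ⟨i₀, by omega⟩⟩ with ht₁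
  set t₂ : Fin (∑ j, kv j) := finSigmaFinEquiv (n := kv) ⟨j₀, ⟨kv j₀ - 1, by omega⟩⟩ with ht₂
  -- the pointwise change of each entry
  have hpt : ∀ t : Fin (∑ j, kv j), flatFrag kv ξ (Function.update U (j₀, i₀) u) t - flatFrag kv ξ U t =
      ((if t = t₁ then 1 else 0) - (if t = t₂ then 1 else 0)) * (u - U (j₀, i₀)) := by
    intro t
    obtain ⟨⟨j, i⟩, rfl⟩ := (finSigmaFinEquiv (n := kv)).surjective t
    rw [flatFrag_apply, flatFrag_apply]
    simp only []
    rw [rowOf_update]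
    have hinj : ∀ (p p' : (j : Fin m) × Fin (kv j)), finSigmaFinEquiv (n := kv) p = finSigmaFinEquiv (n := kv) p' ↔ p = p' :=
      fun p p' => (finSigmaFinEquiv (n := kv)).injective.eq_iff
    by_cases hj : j = j₀
    · subst hj
      rw [if_pos rfl, blockVec_update_sub (kv j) (ξ j) (rowOf U j) hi₀ u i]
      have hrow : rowOf U j (i₀ : ℕ) = U (j, i₀) := by simp [rowOf, i₀.2]
      rw [hrow]
      have e1 : (if (i : ℕ) = i₀ then (1 : ℝ) else 0) =
          if finSigmaFinEquiv (n := kv) ⟨j, i⟩ = t₁ then 1 else 0 := by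
        by_cases hii : (i : ℕ) = i₀
        · have : finSigmaFinEquiv (n := kv) ⟨j, i⟩ = t₁ := by
            rw [ht₁]; congr 1; congr 1; exact Fin.ext hii
          rw [if_pos hii, if_pos this]
        · have : finSigmaFinEquiv (n := kv) ⟨j, i⟩ ≠ t₁ := by
            rw [ht₁, Ne, hinj]; intro h
            rw [Sigma.mk.inj_iff] at h
            exact hii (congrArg Fin.val (eq_of_heq h.2))
          rw [if_neg hii, if_neg this]
      have e2 : (if (i : ℕ) + 1 < kv j then (0 : ℝ) else 1) =
          if finSigmaFinEquiv (n := kv) ⟨j, i⟩ = t₂ then 1 else 0 := by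
        by_cases hlast : (i : ℕ) + 1 < kv j
        · have : finSigmaFinEquiv (n := kv) ⟨j, i⟩ ≠ t₂ := by
            rw [ht₂, Ne, hinj]; intro h
            rw [Sigma.mk.inj_iff] at h
            have := congrArg Fin.val (eq_of_heq h.2); simp at this; omega
          rw [if_pos hlast, if_neg this]
        · have : finSigmaFinEquiv (n := kv) ⟨j, i⟩ = t₂ := by
            rw [ht₂]; congr 1; congr 1; exact Fin.ext (by simp; omega)
          rw [if_neg hlast, if_pos this]
      rw [e1, e2]
    · rw [if_neg hj, sub_self]
      have h1 : finSigmaFinEquiv (n := kv) ⟨j, i⟩ ≠ t₁ := by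
        rw [ht₁, Ne, hinj]; intro h; exact hj (congrArg Sigma.fst h)
      have h2 : finSigmaFinEquiv (n := kv) ⟨j, i⟩ ≠ t₂ := by
        rw [ht₂, Ne, hinj]; intro h; exact hj (congrArg Sigma.fst h)
      rw [if_neg h1, if_neg h2]; ring
  unfold subsumFn
  have : ∑ t ∈ A, flatFrag kv ξ (Function.update U (j₀, i₀) u) t =
      ∑ t ∈ A, (flatFrag kv ξ U t + ((if t = t₁ then 1 else 0) - (if t = t₂ then 1 else 0)) * (u - U (j₀, i₀))) :=
    Finset.sum_congr rfl fun t _ => by rw [← hpt t]; ring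
  rw [this, Finset.sum_add_distrib, ← Finset.sum_mul, Finset.sum_sub_distrib,
    Finset.sum_ite_eq' A t₁ (fun _ => (1 : ℝ)), Finset.sum_ite_eq' A t₂ (fun _ => (1 : ℝ))]

/-! ### Index sets: unions of whole blocks versus mixed sets -/

/-- The indices of the `j`-th block inside `Fin (k₁ + ⋯ + k_m)`. [folklore] -/
def blockIdx (kv : Fin m → ℕ) (j : Fin m) : Finset (Fin (∑ j, kv j)) :=
  Finset.univ.image fun i : Fin (kv j) => finSigmaFinEquiv (n := kv) ⟨j, i⟩

/-- `A` is a union of whole blocks. [folklore] -/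
def IsPure (kv : Fin m → ℕ) (A : Finset (Fin (∑ j, kv j))) : Prop :=
  ∀ j, blockIdx kv j ⊆ A ∨ Disjoint (blockIdx kv j) A

/-- Membership in a block of indices. [folklore] -/
theorem mem_blockIdx_iff (kv : Fin m → ℕ) (j : Fin m) (t : Fin (∑ j, kv j)) :
    t ∈ blockIdx kv j ↔ ((finSigmaFinEquiv (n := kv)).symm t).1 = j := by
  unfold blockIdx
  rw [Finset.mem_image]
  constructor
  · rintro ⟨i, -, rfl⟩; simp
  · intro h
    obtain ⟨⟨j', i⟩, rfl⟩ := (finSigmaFinEquiv (n := kv)).surjective t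
    simp only [Equiv.symm_apply_apply] at h
    subst h
    exact ⟨i, Finset.mem_univ _, rfl⟩

/-- **Mixed index sets have a free coordinate with slope `±1`.** If `A` is not a union of whole
blocks (and `k_j ≤ N`), there are a block `j₀` and a free position `i₀` (`i₀ + 1 < k_{j₀}`) such
that `𝟙[(j₀,i₀) ∈ A] − 𝟙[(j₀, last) ∈ A] = ±1`. [cite: FordMaynard2024PrimeSieves, §9 (proof of Theorem 9.1: "Pick i', i'' so that i' ∈ L_{j'} and i'' ∈ [k_{j'}] ∖ L_{j'}")] -/
theorem exists_slope_of_mixed (kv : Fin m → ℕ) (hkvN : ∀ j, kv j ≤ N) (A : Finset (Fin (∑ j, kv j)))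
    (hA : ¬ IsPure kv A) :
    ∃ (j₀ : Fin m) (i₀ : Fin N) (h : (i₀ : ℕ) + 1 < kv j₀),
      ((if finSigmaFinEquiv (n := kv) ⟨j₀, ⟨i₀, by omega⟩⟩ ∈ A then (1 : ℝ) else 0) -
          (if finSigmaFinEquiv (n := kv) ⟨j₀, ⟨kv j₀ - 1, by omega⟩⟩ ∈ A then 1 else 0) = 1) ∨
      ((if finSigmaFinEquiv (n := kv) ⟨j₀, ⟨i₀, by omega⟩⟩ ∈ A then (1 : ℝ) else 0) -
          (if finSigmaFinEquiv (n := kv) ⟨j₀, ⟨kv j₀ - 1, by omega⟩⟩ ∈ A then 1 else 0) = -1) := by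
  classical
  unfold IsPure at hA
  push Not at hA
  obtain ⟨j₀, hnsub, hndisj⟩ := hA
  obtain ⟨tout, htout, htoutA⟩ := Finset.not_subset.1 hnsub
  obtain ⟨tin, htin, htinA⟩ : ∃ t ∈ blockIdx kv j₀, t ∈ A := by
    simpa [Finset.disjoint_left] using hndisj
  unfold blockIdx at htout htin
  rw [Finset.mem_image] at htout htin
  obtain ⟨iout, -, rfl⟩ := htout
  obtain ⟨iin, -, rfl⟩ := htin
  have hk1 : 1 ≤ kv j₀ := Nat.one_le_iff_ne_zero.2 fun h0 => by
    have := iin.2; omega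
  set last : Fin (kv j₀) := ⟨kv j₀ - 1, by omega⟩ with hlast
  have hinj := (finSigmaFinEquiv (n := kv)).injective
  by_cases h2 : finSigmaFinEquiv (n := kv) ⟨j₀, last⟩ ∈ A
  · -- the last entry is in `A`: use the entry outside `A`, slope `−1`
    have hne : iout ≠ last := by
      intro h; apply htoutA; rw [h]; exact h2
    have hfree : (iout : ℕ) + 1 < kv j₀ := by
      have h1 : (iout : ℕ) ≠ kv j₀ - 1 := fun h => hne (Fin.ext (by rw [hlast]; exact h))
      have := iout.2; omega
    refine ⟨j₀, Fin.castLE (hkvN j₀) iout, by rw [Fin.val_castLE]; exact hfree, Or.inr ?_⟩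
    have e1 : (⟨((Fin.castLE (hkvN j₀) iout : Fin N) : ℕ), by rw [Fin.val_castLE]; exact iout.2⟩ : Fin (kv j₀)) = iout :=
      Fin.ext (Fin.val_castLE (hkvN j₀) iout)
    have e2 : (⟨kv j₀ - 1, by omega⟩ : Fin (kv j₀)) = last := rfl
    rw [e1, e2, if_neg htoutA, if_pos h2]; ring
  · -- the last entry is not in `A`: use the entry inside `A`, slope `+1`
    have hne : iin ≠ last := by
      intro h; apply h2; rw [← h]; exact htinA
    have hfree : (iin : ℕ) + 1 < kv j₀ := by
      have h1 : (iin : ℕ) ≠ kv j₀ - 1 := fun h => hne (Fin.ext (by rw [hlast]; exact h))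
      have := iin.2; omega
    refine ⟨j₀, Fin.castLE (hkvN j₀) iin, by rw [Fin.val_castLE]; exact hfree, Or.inl ?_⟩
    have e1 : (⟨((Fin.castLE (hkvN j₀) iin : Fin N) : ℕ), by rw [Fin.val_castLE]; exact iin.2⟩ : Fin (kv j₀)) = iin :=
      Fin.ext (Fin.val_castLE (hkvN j₀) iin)
    have e2 : (⟨kv j₀ - 1, by omega⟩ : Fin (kv j₀)) = last := rfl
    rw [e1, e2, if_pos htinA, if_neg h2]; ring

/-- **Subsums over unions of whole blocks are subsums of `ξ`** (block sums are the `ξ_j`), with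
the same (non)triviality. [cite: FordMaynard2024PrimeSieves, §9 (proof of Theorem 9.1: "If, for all j, L_j is empty or L_j = [k_j], then A is a proper subsum of ξ")] -/
theorem subsumFn_of_isPure (kv : Fin m → ℕ) (hkv : ∀ j, 1 ≤ kv j) (ξ : Fin m → ℝ)
    (A : Finset (Fin (∑ j, kv j))) (hA : IsPure kv A) (U : Fin m × Fin N → ℝ) :
    subsumFn kv ξ A U = ∑ j ∈ Finset.univ.filter (fun j => blockIdx kv j ⊆ A), ξ j ∧
      (A.Nonempty → (Finset.univ.filter (fun j => blockIdx kv j ⊆ A)).Nonempty) ∧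
      (A ≠ Finset.univ → Finset.univ.filter (fun j => blockIdx kv j ⊆ A) ≠ Finset.univ) := by
  classical
  set J := Finset.univ.filter (fun j => blockIdx kv j ⊆ A) with hJ
  have hmemJ : ∀ j, j ∈ J ↔ blockIdx kv j ⊆ A := fun j => by rw [hJ, Finset.mem_filter]; simp
  -- `A` is the union of the blocks in `J`
  have hAeq : A = J.biUnion (blockIdx kv) := by
    ext t
    rw [Finset.mem_biUnion]
    constructor
    · intro ht
      set j := ((finSigmaFinEquiv (n := kv)).symm t).1 with hj
      have htb : t ∈ blockIdx kv j := (mem_blockIdx_iff kv j t).2 rfl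
      refine ⟨j, (hmemJ j).2 ?_, htb⟩
      rcases hA j with h | h
      · exact h
      · exact absurd ht (Finset.disjoint_left.1 h htb)
    · rintro ⟨j, hj, ht⟩
      exact (hmemJ j).1 hj ht
  have hdisj : Set.PairwiseDisjoint (↑J : Set (Fin m)) (blockIdx kv) := by
    intro j _ j' _ hjj'
    rw [Function.onFun, Finset.disjoint_left]
    intro t ht ht'
    exact hjj' (((mem_blockIdx_iff kv j t).1 ht).symm.trans ((mem_blockIdx_iff kv j' t).1 ht'))
  refine ⟨?_, ?_, ?_⟩
  · unfold subsumFn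
    rw [hAeq, Finset.sum_biUnion hdisj]
    refine Finset.sum_congr rfl fun j _ => ?_
    unfold blockIdx
    rw [Finset.sum_image fun i _ i' _ h => by
      have := (finSigmaFinEquiv (n := kv)).injective h
      rw [Sigma.mk.inj_iff] at this
      exact eq_of_heq this.2]
    simp only [flatFrag_apply]
    exact sum_blockVec (hkv j) (ξ j) (rowOf U j)
  · rintro ⟨t, ht⟩
    rw [hAeq, Finset.mem_biUnion] at ht
    obtain ⟨j, hj, -⟩ := ht
    exact ⟨j, hj⟩
  · intro hAu hJu
    apply hAu
    rw [hAeq, hJu]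
    ext t
    simp only [Finset.mem_biUnion, Finset.mem_univ, true_and, iff_true]
    exact ⟨_, (mem_blockIdx_iff kv _ t).2 rfl⟩

/-! ### The set of bad fragmentations is a finite union of thin slabs -/

/-- A vector has a nonempty proper subsum in one of the intervals `[lo_l, lo_l + w_l]`.
[cite: FordMaynard2024PrimeSieves, §9 (the sets 𝒟_{k,η}(P)) and §6.2 (the set 𝓘_ε)] -/
def BadSubsum {L : ℕ} (lo wd : Fin L → ℝ) (n : ℕ) (v : Fin n → ℝ) : Prop :=
  ∃ A : Finset (Fin n), A.Nonempty ∧ A ≠ Finset.univ ∧ ∃ l, lo l ≤ ∑ t ∈ A, v t ∧ ∑ t ∈ A, v t ≤ lo l + wd l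

/-- The set of flat coordinates giving admissible blocks and a bad fragmentation.
[cite: FordMaynard2024PrimeSieves, §9 (proof of (f-ftilde))] -/
def badU (η : ℝ) (kv : Fin m → ℕ) (ξ : Fin m → ℝ) {L : ℕ} (lo wd : Fin L → ℝ) : Set (Fin m × Fin N → ℝ) :=
  {U | (∀ j, BlockCond η N (kv j) (ξ j) (rowOf U j)) ∧ BadSubsum lo wd _ (flatFrag kv ξ U)}

/-- The slab of flat coordinates on which the subsum over `A` lies in the `l`-th interval.
[folklore] -/
def slabU (η : ℝ) (kv : Fin m → ℕ) (ξ : Fin m → ℝ) (A : Finset (Fin (∑ j, kv j))) (lo₀ wd₀ : ℝ) :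
    Set (Fin m × Fin N → ℝ) :=
  {U | (∀ j, BlockCond η N (kv j) (ξ j) (rowOf U j)) ∧ lo₀ ≤ subsumFn kv ξ A U ∧ subsumFn kv ξ A U ≤ lo₀ + wd₀}

/-- Slabs are measurable. [folklore] -/
theorem measurableSet_slabU (η : ℝ) (kv : Fin m → ℕ) (ξ : Fin m → ℝ) (A : Finset (Fin (∑ j, kv j)))
    (lo₀ wd₀ : ℝ) : MeasurableSet (slabU (N := N) η kv ξ A lo₀ wd₀) := by
  unfold slabU
  refine MeasurableSet.inter ?_ (MeasurableSet.inter ?_ ?_)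
  · exact (Measurable.forall fun j => measurable_blockCond η N (kv j) (ξ j) (measurable_rowOf j)).setOf
  · exact measurableSet_le measurable_const (measurable_subsumFn kv ξ A)
  · exact measurableSet_le (measurable_subsumFn kv ξ A) measurable_const

/-- **Volume of one slab**: `vol(slabU A l) ≤ 2 w (1 + ∑|ξ_j|)^{mN−1}` for a mixed `A`.
[cite: FordMaynard2024PrimeSieves, §9 (proof of (f-ftilde))] -/
theorem volume_slabU_toReal_le (η : ℝ) (kv : Fin m → ℕ) (hkvN : ∀ j, kv j ≤ N) (ξ : Fin m → ℝ)
    (A : Finset (Fin (∑ j, kv j))) (hA : ¬ IsPure kv A) (lo₀ : ℝ) {wd₀ : ℝ} (hwd : 0 ≤ wd₀) :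
    (volume (slabU (N := N) η kv ξ A lo₀ wd₀)).toReal ≤ 2 * wd₀ * (1 + ∑ j, |ξ j|) ^ (m * N - 1) := by
  classical
  obtain ⟨j₀, i₀, hfree, hslope⟩ := exists_slope_of_mixed kv hkvN A hA
  have hR : 0 ≤ 1 + ∑ j, |ξ j| := by positivity
  have hcard : Fintype.card (Fin m × Fin N) = m * N := by simp
  rw [← hcard]
  refine volume_toReal_le_of_section' (j₀, i₀) (measurableSet_slabU η kv ξ A lo₀ wd₀) hR hwd
    (fun U hU q => ?_) (subsumFn kv ξ A) (s := _) hslope.symm.symm (fun U u => subsumFn_update kv ξ A U hfree u)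
    (fun U hU => hU.2)
  have := mem_Ioo_of_blockCond hU.1 q
  exact ⟨this.1.le, this.2.le⟩

open scoped Classical in
/-- The finite union of the slabs over mixed index sets and all intervals. [folklore] -/
def badUnion (η : ℝ) (kv : Fin m → ℕ) (ξ : Fin m → ℝ) {L : ℕ} (lo wd : Fin L → ℝ) : Set (Fin m × Fin N → ℝ) :=
  ⋃ A ∈ (Finset.univ : Finset (Finset (Fin (∑ j, kv j)))).filter (fun A => ¬ IsPure kv A),
    ⋃ l ∈ (Finset.univ : Finset (Fin L)), slabU η kv ξ A (lo l) (wd l)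

/-- `badUnion` is measurable. [folklore] -/
theorem measurableSet_badUnion (η : ℝ) (kv : Fin m → ℕ) (ξ : Fin m → ℝ) {L : ℕ} (lo wd : Fin L → ℝ) :
    MeasurableSet (badUnion (N := N) η kv ξ lo wd) := by
  unfold badUnion
  exact Finset.measurableSet_biUnion _ fun A _ => Finset.measurableSet_biUnion _ fun l _ =>
    measurableSet_slabU η kv ξ A (lo l) (wd l)

/-- `badU ⊆ badUnion` when `ξ` itself has no bad subsum: a subsum over a union of whole blocks is a
subsum of `ξ`. [cite: FordMaynard2024PrimeSieves, §9 (proof of (f-ftilde))] -/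
theorem badU_subset_badUnion (η : ℝ) (kv : Fin m → ℕ) (hkv : ∀ j, 1 ≤ kv j) (ξ : Fin m → ℝ) {L : ℕ}
    (lo wd : Fin L → ℝ) (hξ : ¬ BadSubsum lo wd m ξ) :
    badU (N := N) η kv ξ lo wd ⊆ badUnion η kv ξ lo wd := by
  classical
  intro U hU
  obtain ⟨hc, A, hAne, hAuniv, l, h1, h2⟩ := hU
  unfold badUnion
  refine Set.mem_iUnion₂.2 ⟨A, Finset.mem_filter.2 ⟨Finset.mem_univ _, fun hpure => ?_⟩,
    Set.mem_iUnion₂.2 ⟨l, Finset.mem_univ _, hc, h1, h2⟩⟩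
  obtain ⟨hsum, hJne, hJuniv⟩ := subsumFn_of_isPure kv hkv ξ A hpure U
  apply hξ
  refine ⟨Finset.univ.filter (fun j => blockIdx kv j ⊆ A), hJne hAne, hJuniv hAuniv, l, ?_, ?_⟩
  · rw [← hsum]; exact h1
  · rw [← hsum]; exact h2

/-- **Volume of the bad slabs**: `vol(badUnion) ≤ 2^{k₁+⋯+k_m} · 2 (1 + ∑|ξ_j|)^{mN−1} · ∑_l w_l`.
[cite: FordMaynard2024PrimeSieves, §9 (proof of (f-ftilde)), §6.2 (proof of (fh1))] -/
theorem volume_badUnion_le (η : ℝ) (kv : Fin m → ℕ) (hkvN : ∀ j, kv j ≤ N)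
    (ξ : Fin m → ℝ) {L : ℕ} (lo wd : Fin L → ℝ) (hwd : ∀ l, 0 ≤ wd l) :
    volume (badUnion (N := N) η kv ξ lo wd) ≤
      ENNReal.ofReal ((2 : ℝ) ^ (∑ j, kv j) * (2 * (1 + ∑ j, |ξ j|) ^ (m * N - 1) * ∑ l, wd l)) := by
  classical
  set M := (Finset.univ : Finset (Finset (Fin (∑ j, kv j)))).filter (fun A => ¬ IsPure kv A) with hM
  set R := 1 + ∑ j, |ξ j| with hR
  have hle : volume (badUnion (N := N) η kv ξ lo wd) ≤
      ∑ A ∈ M, ∑ l, ENNReal.ofReal (2 * wd l * R ^ (m * N - 1)) := by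
    unfold badUnion
    refine (measure_biUnion_finset_le _ _).trans (Finset.sum_le_sum fun A hA => ?_)
    refine (measure_biUnion_finset_le _ _).trans (Finset.sum_le_sum fun l _ => ?_)
    have hA' : ¬ IsPure kv A := (Finset.mem_filter.1 hA).2
    have hfin : volume (slabU (N := N) η kv ξ A (lo l) (wd l)) < ⊤ := by
      refine lt_of_le_of_lt (measure_mono fun U hU => ?_)
        (isCompact_Icc (a := fun _ => (0 : ℝ)) (b := fun _ => R)).measure_lt_top
      exact ⟨fun q => (mem_Ioo_of_blockCond hU.1 q).1.le, fun q => (mem_Ioo_of_blockCond hU.1 q).2.le⟩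
    rw [← ENNReal.ofReal_toReal hfin.ne]
    exact ENNReal.ofReal_le_ofReal (volume_slabU_toReal_le η kv hkvN ξ A hA' (lo l) (hwd l))
  have hx0 : ∀ l, 0 ≤ 2 * wd l * R ^ (m * N - 1) := fun l => by have := hwd l; positivity
  have hsum_eq : ∑ A ∈ M, ∑ l, ENNReal.ofReal (2 * wd l * R ^ (m * N - 1)) =
      ENNReal.ofReal (∑ A ∈ M, ∑ l, 2 * wd l * R ^ (m * N - 1)) := by
    rw [ENNReal.ofReal_sum_of_nonneg (fun A _ => Finset.sum_nonneg fun l _ => hx0 l)]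
    refine Finset.sum_congr rfl fun A _ => ?_
    rw [ENNReal.ofReal_sum_of_nonneg (fun l _ => hx0 l)]
  have hcard : (M.card : ℝ) ≤ 2 ^ (∑ j, kv j) := by
    have : M.card ≤ (Finset.univ : Finset (Finset (Fin (∑ j, kv j)))).card := Finset.card_filter_le _ _
    rw [Finset.card_univ, Fintype.card_finset, Fintype.card_fin] at this
    exact_mod_cast this
  have hreal : ∑ A ∈ M, ∑ l, 2 * wd l * R ^ (m * N - 1) ≤
      (2 : ℝ) ^ (∑ j, kv j) * (2 * R ^ (m * N - 1) * ∑ l, wd l) := by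
    rw [Finset.sum_const, nsmul_eq_mul]
    have hS0 : 0 ≤ ∑ l, 2 * wd l * R ^ (m * N - 1) := Finset.sum_nonneg fun l _ => hx0 l
    have hS : ∑ l, 2 * wd l * R ^ (m * N - 1) = 2 * R ^ (m * N - 1) * ∑ l, wd l := by
      rw [Finset.mul_sum]; refine Finset.sum_congr rfl fun l _ => by ring
    rw [← hS]
    exact mul_le_mul_of_nonneg_right hcard hS0
  rw [hsum_eq] at hle
  exact hle.trans (ENNReal.ofReal_le_ofReal hreal)

/-! ### The bound for `fragOp` of a function cut off on bad vectors -/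

open scoped Classical in
/-- `g` restricted to the vectors having a bad subsum. [cite: FordMaynard2024PrimeSieves, §9 (f − f̃ on small vectors)] -/
def badCut {L : ℕ} (lo wd : Fin L → ℝ) (g : VecFn) : VecFn := fun n v => if BadSubsum lo wd n v then g n v else 0

/-- `badCut` is measurable in each dimension. [folklore] -/
theorem measurable_badCut {L : ℕ} (lo wd : Fin L → ℝ) {g : VecFn} (hgm : ∀ n, Measurable (g n)) (n : ℕ) :
    Measurable (badCut lo wd g n) := by
  classical
  unfold badCut
  refine Measurable.ite ?_ (hgm n) measurable_const
  unfold BadSubsum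
  have : {a : Fin n → ℝ | ∃ A : Finset (Fin n), A.Nonempty ∧ A ≠ Finset.univ ∧
      ∃ l, lo l ≤ ∑ t ∈ A, a t ∧ ∑ t ∈ A, a t ≤ lo l + wd l} =
      ⋃ A : Finset (Fin n), ⋃ l : Fin L, {a | (A.Nonempty ∧ A ≠ Finset.univ) ∧
        (lo l ≤ ∑ t ∈ A, a t ∧ ∑ t ∈ A, a t ≤ lo l + wd l)} := by
    ext a; simp [and_assoc]
  rw [this]
  refine MeasurableSet.iUnion fun A => MeasurableSet.iUnion fun l => ?_
  by_cases hA : A.Nonempty ∧ A ≠ Finset.univ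
  · have : {a : Fin n → ℝ | (A.Nonempty ∧ A ≠ Finset.univ) ∧ (lo l ≤ ∑ t ∈ A, a t ∧ ∑ t ∈ A, a t ≤ lo l + wd l)} =
        {a | lo l ≤ ∑ t ∈ A, a t} ∩ {a | ∑ t ∈ A, a t ≤ lo l + wd l} := by
      ext a; simp [hA]
    rw [this]
    exact (measurableSet_le measurable_const (Finset.measurable_sum _ fun t _ => measurable_pi_apply t)).inter
      (measurableSet_le (Finset.measurable_sum _ fun t _ => measurable_pi_apply t) measurable_const)
  · have : {a : Fin n → ℝ | (A.Nonempty ∧ A ≠ Finset.univ) ∧ (lo l ≤ ∑ t ∈ A, a t ∧ ∑ t ∈ A, a t ≤ lo l + wd l)} = ∅ := by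
      ext a; simp only [Set.mem_setOf_eq, Set.mem_empty_iff_false, iff_false]; exact fun h => hA h.1
    rw [this]; exact MeasurableSet.empty

/-- `|badCut g| ≤ |g|`-type bound. [folklore] -/
theorem abs_badCut_le {L : ℕ} (lo wd : Fin L → ℝ) {g : VecFn} {F : ℝ} (hF : ∀ n v, |g n v| ≤ F) (n : ℕ)
    (v : Fin n → ℝ) : |badCut lo wd g n v| ≤ F := by
  classical
  unfold badCut; split_ifs
  · exact hF n v
  · rw [abs_zero]; exact (abs_nonneg _).trans (hF 0 fun i => i.elim0)

/-- **The measure argument, quantitative form.** Let `g` be bounded by `F`, let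
`g_B` be `g` restricted to the vectors with a nonempty proper subsum in `⋃_l [lo_l, lo_l + w_l]`,
and let `ξ ∈ [0,1]^m` have no such subsum. Then
`|fragOp γ η g_B (ξ)| ≤ N^m (N (2^N)^N/η^N)^m F · 2^{mN} · 2 (1+m)^{mN−1} ∑_l w_l`, `N = ⌊1/η⌋`.
[cite: FordMaynard2024PrimeSieves, §9 (proof of (f-ftilde)) and §6.2 (proof of (fh1))] -/
theorem abs_fragOp_badCut_le {γ η : ℝ} (hη : 0 < η) (hη1 : η ≤ 1) {g : VecFn}
    {F : ℝ} (hF : ∀ n v, |g n v| ≤ F) {L : ℕ} (lo wd : Fin L → ℝ) (hwd : ∀ l, 0 ≤ wd l)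
    {m : ℕ} (ξ : Fin m → ℝ) (hξ : ∀ j, 0 ≤ ξ j ∧ ξ j ≤ 1) (hbad : ¬ BadSubsum lo wd m ξ) :
    |fragOp γ η (badCut lo wd g) m ξ| ≤
      (maxBlock η : ℝ) ^ m * ((maxBlock η * (2 ^ maxBlock η) ^ maxBlock η / η ^ maxBlock η) ^ m * F) *
        ((2 : ℝ) ^ (m * maxBlock η) * (2 * (1 + m) ^ (m * maxBlock η - 1) * ∑ l, wd l)) := by
  classical
  set N := maxBlock η with hN
  set Wb : ℝ := (N * (2 ^ N) ^ N / η ^ N) ^ m * F with hWb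
  set V : ℝ := (2 : ℝ) ^ (m * N) * (2 * (1 + m) ^ (m * N - 1) * ∑ l, wd l) with hV
  have hF0 : 0 ≤ F := (abs_nonneg _).trans (hF 0 fun i => i.elim0)
  have hWb0 : 0 ≤ Wb := by rw [hWb]; positivity
  have hwd0 : 0 ≤ ∑ l, wd l := Finset.sum_nonneg fun l _ => hwd l
  have hV0 : 0 ≤ V := by rw [hV]; positivity
  -- `|∏ ξ_j| ≤ 1`
  have hprod : |∏ j, ξ j| ≤ 1 := by
    rw [Finset.abs_prod]
    exact Finset.prod_le_one (fun j _ => abs_nonneg _) fun j _ => by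
      rw [abs_of_nonneg (hξ j).1]; exact (hξ j).2
  have hR : 1 + ∑ j, |ξ j| ≤ 1 + m := by
    have : ∑ j, |ξ j| ≤ ∑ _j : Fin m, (1 : ℝ) := Finset.sum_le_sum fun j _ => by
      rw [abs_of_nonneg (hξ j).1]; exact (hξ j).2
    simpa using this
  -- each term of (6.3)
  have hterm : ∀ kv ∈ Fintype.piFinset (fun _ : Fin m => Finset.Icc 1 N),
      |∫ U : Fin m × Fin N → ℝ, fragIntegrand γ η N (badCut lo wd g) kv ξ U| ≤ Wb * V := by
    intro kv hkv
    have hkv' : ∀ j, 1 ≤ kv j ∧ kv j ≤ N := fun j => by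
      have := Fintype.mem_piFinset.1 hkv j; simpa using this
    set T := badUnion (N := N) η kv ξ lo wd with hT
    have hTm : MeasurableSet T := measurableSet_badUnion η kv ξ lo wd
    have hvolT := volume_badUnion_le (N := N) η kv (fun j => (hkv' j).2) ξ lo wd hwd
    have hsub := badU_subset_badUnion (N := N) η kv (fun j => (hkv' j).1) ξ lo wd hbad
    -- the volume bound for `T`, simplified
    have hVkv : (2 : ℝ) ^ (∑ j, kv j) * (2 * (1 + ∑ j, |ξ j|) ^ (m * N - 1) * ∑ l, wd l) ≤ V := by
      rw [hV]
      have h1 : (2 : ℝ) ^ (∑ j, kv j) ≤ 2 ^ (m * N) := by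
        refine pow_le_pow_right₀ (by norm_num) ?_
        calc ∑ j, kv j ≤ ∑ _j : Fin m, N := Finset.sum_le_sum fun j _ => (hkv' j).2
          _ = m * N := by simp
      have h2 : (1 + ∑ j, |ξ j|) ^ (m * N - 1) ≤ (1 + (m : ℝ)) ^ (m * N - 1) :=
        pow_le_pow_left₀ (by positivity) hR _
      have h3 : 0 ≤ 2 * (1 + ∑ j, |ξ j|) ^ (m * N - 1) * ∑ l, wd l := by positivity
      calc (2 : ℝ) ^ (∑ j, kv j) * (2 * (1 + ∑ j, |ξ j|) ^ (m * N - 1) * ∑ l, wd l)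
          ≤ 2 ^ (m * N) * (2 * (1 + ∑ j, |ξ j|) ^ (m * N - 1) * ∑ l, wd l) :=
            mul_le_mul_of_nonneg_right h1 h3
        _ ≤ 2 ^ (m * N) * (2 * (1 + (m : ℝ)) ^ (m * N - 1) * ∑ l, wd l) := by
            refine mul_le_mul_of_nonneg_left ?_ (by positivity)
            exact mul_le_mul_of_nonneg_right (mul_le_mul_of_nonneg_left h2 (by norm_num)) hwd0
    have hvolT' : volume T ≤ ENNReal.ofReal V := hvolT.trans (ENNReal.ofReal_le_ofReal hVkv)
    have hTreal : (volume T).toReal ≤ V := ENNReal.toReal_le_of_le_ofReal hV0 hvolT'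
    have hTfin : volume T < ⊤ := lt_of_le_of_lt hvolT' ENNReal.ofReal_lt_top
    -- pointwise bound by `Wb · 𝟙_T`
    have hptw : ∀ U, ‖fragIntegrand γ η N (badCut lo wd g) kv ξ U‖ ≤ Wb * T.indicator 1 U := by
      intro U
      rw [Real.norm_eq_abs, fragIntegrand_eq_flat]
      split_ifs with hc
      · have hflat : (concatBlocks kv fun j => blockVec (kv j) (ξ j) (rowOf U j)) = flatFrag kv ξ U := rfl
        rw [hflat]
        show |(∏ j, blockWeight γ (kv j) fun i => flatFrag kv ξ U (finSigmaFinEquiv ⟨j, i⟩)) *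
            badCut lo wd g (∑ j, kv j) (flatFrag kv ξ U)| ≤ Wb * T.indicator 1 U
        by_cases hB : BadSubsum lo wd _ (flatFrag (N := N) kv ξ U)
        · have hUT : U ∈ T := hsub ⟨hc, hB⟩
          rw [Set.indicator_of_mem hUT, Pi.one_apply, mul_one]
          exact abs_flatH_le hη hη1 (abs_badCut_le lo wd hF) hkv' _ (le_concatBlocks_of_blockCond hc)
        · have : badCut lo wd g (∑ j, kv j) (flatFrag kv ξ U) = 0 := by
            unfold badCut; rw [if_neg hB]
          rw [this, mul_zero, abs_zero]
          exact mul_nonneg hWb0 (Set.indicator_nonneg (fun _ _ => zero_le_one) _)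
      · rw [abs_zero]; exact mul_nonneg hWb0 (Set.indicator_nonneg (fun _ _ => zero_le_one) _)
    have hint : Integrable (fun U : Fin m × Fin N → ℝ => Wb * T.indicator 1 U) := by
      refine Integrable.const_mul ?_ _
      rw [integrable_indicator_iff hTm]
      exact integrableOn_const hTfin.ne
    calc |∫ U : Fin m × Fin N → ℝ, fragIntegrand γ η N (badCut lo wd g) kv ξ U|
        = ‖∫ U : Fin m × Fin N → ℝ, fragIntegrand γ η N (badCut lo wd g) kv ξ U‖ := (Real.norm_eq_abs _).symm
      _ ≤ ∫ U : Fin m × Fin N → ℝ, Wb * T.indicator 1 U :=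
          norm_integral_le_of_norm_le hint (Filter.Eventually.of_forall hptw)
      _ = Wb * (volume T).toReal := by rw [integral_const_mul, integral_indicator_one hTm]; rfl
      _ ≤ Wb * V := mul_le_mul_of_nonneg_left hTreal hWb0
  -- summing over the `N^m` block-size vectors
  have hcard : ((Fintype.piFinset (fun _ : Fin m => Finset.Icc 1 N)).card : ℝ) = (N : ℝ) ^ m := by
    rw [Fintype.card_piFinset]; simp
  unfold fragOp
  rw [abs_mul]
  calc |∏ j, ξ j| * |∑ kv ∈ Fintype.piFinset (fun _ : Fin m => Finset.Icc 1 (maxBlock η)),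
        ∫ U : Fin m × Fin (maxBlock η) → ℝ, fragIntegrand γ η (maxBlock η) (badCut lo wd g) kv ξ U|
      ≤ 1 * ∑ kv ∈ Fintype.piFinset (fun _ : Fin m => Finset.Icc 1 N), (Wb * V) := by
        refine mul_le_mul hprod ((Finset.abs_sum_le_sum_abs _ _).trans (Finset.sum_le_sum hterm)) (abs_nonneg _)
          zero_le_one
    _ = (N : ℝ) ^ m * Wb * V := by rw [one_mul, Finset.sum_const, nsmul_eq_mul, hcard]; ring
    _ = _ := by rw [hWb, hV, hN]

end Literature.NumberTheory.Sieve.FordMaynard
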